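import Literature.NumberTheory.Adeles.TwistedFrameLatticeReadout              -- ★ (7a)(7b)(7c)(8) readings over the abstract datum
import Literature.LinearAlgebra.LatticeIndexLocalReadout                      -- ★ `relIndex_comap_readout_eq`, `eq_of_comap_readout_eq`
import Literature.NumberTheory.LocalFields.AdicCompletionBallLatticeIndex     -- ★ `exists_addSubgroup_ball`, `relIndex_ball_eq_pow`
import Literature.LinearAlgebra.TorsionModuleStableSubgroupsLineCount          -- ★ `exists_eq_of_injective_stableLattice`
import HarnessLib

/-!
# The lattice counts of a twisted frame, I: `[𝔭⁻¹Λ_a : Λ_a] = q²` and exhaustion by `q + 1` stable neighbours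
# ([Shimura 1971] §3.2 Lemma 3.22–3.23; [Milne 2005] §6 Thm. 6.11 p. 74 and p. 75; abstract form of (L-c)(L-c′) of the P6 Hecke-roof census)

Topic `NumberTheory/Adeles`; namespace `Literature.NumberTheory.Adeles.Readout`.  THEOREMS ONLY (no definition, no named fact, no instance, no notation,
no `sorry`).  Cell `hodgecm-mathlib`, half A line L5, X-LEAF socket `stub_EHECKE`, organ (O-L) part 2 = FILE B (DEAL L5-#6, LA5-p02 (g3)), ASSEMBLY layer, part I
(part II = ★ `TwistedFrameHeckeNeighbourLattice`: the lattices `H(g)`): the four generic engines ★ `LatticeIndexLocalReadout` (the index is read locally under density), ★ `AdicCompletionBallLatticeIndex` (`[B(e) : B(e+k)]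
= q^{Σk}`), ★ `TorsionModuleStableSubgroupsLineCount` (`q + 1` stable lines, lattice glue) and ★ `TwistedFrameLatticeReadout` ((7a)(7b)(7c) memberships,
(8) density) are zipped over the ABSTRACT READOUT DATUM of that file — a ring homomorphism `A : M₂(𝔸_{F,f}) →+* M_N(𝔸_{ℚ,f})`, a place `u₀`, its
idempotent `ε`, the local coordinate `θ : 𝔸_{ℚ,f}^N →+ F_{u₀}²` with normal form exponent `m`, and the rational reading `ρ` of `𝓞_F` — into the lattice
statements the E-side Hecke roofs consume (★ `SiegelAdelicMarkingStableLines.exists_stableLines`: `hΛ`, `h𝔞`, `hcard`, `hst`, `hinj`, `hexh`):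

* §1 `exists_submodule_forall_mulVec_mem` — the lattices `𝔞⁻¹Λ := {q | ρ(𝔞) q ⊆ Λ}` exist as `ℤ`-submodules (no definition is introduced);
  `mulVec_mem_latticeOfGL_map` — `Λ_a` is `ρ(𝓞_F)`-stable; `mulVec_mem_of_forall_mulVec_mem` — so is every `𝔞⁻¹Λ_a ⊓ 𝔟⁻¹Λ_{a′}`.
* §2 (L-c′) `relIndex_latticeOfGL_map_idealInv_eq_sq` — **`[𝔭_{u₀}⁻¹Λ_a : Λ_a] = q²`**, `q = #(𝓞_F ∕ 𝔭_{u₀})`: both lattices are readouts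
  `ι⁻¹(Away ⊓ θ⁻¹B)` of the balls `B(m,m) ≤ B(m−1,m−1)` ((7a)(7b)), density (8) makes the index local, and `[B(m−1,m−1) : B(m,m)] = q²`.
* §3 (L-c′, exhaustion) `exists_eq_of_injective_heckeNeighbour` — an injective family of `q + 1` `ρ`-stable lattices `Λ_a ≤ H_i ≤ 𝔭⁻¹Λ_a` of index `q`
  EXHAUSTS the `ρ`-stable index-`q` lattices between `Λ_a` and `𝔭⁻¹Λ_a` (★ `exists_eq_of_injective_stableLattice` with §2).

## References
* [ShimuraIATAF1971] G. Shimura, *Introduction to the Arithmetic Theory of Automorphic Functions* (1971), §3.2 (Lemma 3.22–3.23: the `q + 1` neighbours).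
* [Milne2005ShimuraVarieties] J. S. Milne, *Introduction to Shimura varieties* (2005), §4 pp. 48–49, §6 Thm. 6.11 p. 74 and p. 75.
* [PlatonovRapinchuk1994] V. Platonov, A. Rapinchuk, *Algebraic groups and number theory* (1994), §8.1 (a lattice is determined by its localisations).
* [DiamondShurman2005] F. Diamond, J. Shurman, *A First Course in Modular Forms* (2005), §5.2 (double coset `Γ diag(1,p) Γ`, `p + 1` representatives).

#harness_tags number_theory.adeles, linear_algebra.lattices, number_theory.shimura_varieties
-/

set_option autoImplicit false

noncomputable section

open Matrix NumberField IsDedekindDomain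
open Literature.AlgebraicGeometry.ModuliOfAbelianVarieties (finAdeleQ)
open Literature.NumberTheory.Automorphic (integralFiniteAdeles)
open Literature.NumberTheory.Adeles (latticeOfGL mem_latticeOfGL_iff)
open Literature.LinearAlgebra (mem_comap_readout_iff relIndex_comap_readout_eq eq_of_comap_readout_eq exists_eq_of_injective_stableLattice)
open Literature.NumberTheory.LocalFields (exists_addSubgroup_ball relIndex_ball_eq_pow)

namespace Literature.NumberTheory.Adeles.Readout

variable {F : Type} [Field F] [NumberField F] {N : Type} [Fintype N] [DecidableEq N]
  (A : Matrix (Fin 2) (Fin 2) (FiniteAdeleRing (𝓞 F) F) →+* Matrix N N finAdeleQ)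
  (u₀ : HeightOneSpectrum (𝓞 F)) (ε : FiniteAdeleRing (𝓞 F) F)
  (θ : (N → finAdeleQ) →+ (Fin 2 → u₀.adicCompletion F)) (m : ℤ)

/-! ### §1 The lattices `𝔞⁻¹Λ` as `ℤ`-submodules; `ρ`-stability -/

omit [NumberField F] in
/-- **`𝔞⁻¹Λ := {q | ρ(b) q ∈ Λ ∀ b ∈ 𝔞}` is a `ℤ`-submodule** (stated as an existence; no definition is introduced — two submodules with this membership are
equal by extensionality). [cite: ShimuraIATAF1971, §3.2] [cite: Milne2005ShimuraVarieties, §6 p. 75] -/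
theorem exists_submodule_forall_mulVec_mem (ρ : 𝓞 F →+* Matrix N N ℚ) (𝔞 : Set (𝓞 F)) (Λ : Submodule ℤ (N → ℚ)) :
    ∃ L : Submodule ℤ (N → ℚ), ∀ q : N → ℚ, q ∈ L ↔ ∀ b ∈ 𝔞, ρ b *ᵥ q ∈ Λ := by
  refine ⟨{ carrier := {q | ∀ b ∈ 𝔞, ρ b *ᵥ q ∈ Λ}
            add_mem' := fun {q q'} hq hq' b hb => ?_
            zero_mem' := fun b _ => by rw [Matrix.mulVec_zero]; exact Λ.zero_mem
            smul_mem' := fun c q hq b hb => ?_ }, fun q => Iff.rfl⟩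
  · rw [Matrix.mulVec_add]
    exact Λ.add_mem (hq b hb) (hq' b hb)
  · rw [Matrix.mulVec_smul]
    exact Λ.smul_mem c (hq b hb)

/-- The reading homomorphism `ι_a : q ↦ A(a⁻¹)·q̂` exists as an additive map. [folklore] -/
private theorem exists_readHom (a : GL (Fin 2) (FiniteAdeleRing (𝓞 F) F)) :
    ∃ ι : (N → ℚ) →+ (N → finAdeleQ), ∀ q : N → ℚ, ι q = A ((a⁻¹ : GL (Fin 2) (FiniteAdeleRing (𝓞 F) F)) : Matrix (Fin 2) (Fin 2) (FiniteAdeleRing (𝓞 F) F)) *ᵥ (⇑(algebraMap ℚ finAdeleQ) ∘ q) := by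
  refine ⟨{ toFun := fun q => A ((a⁻¹ : GL (Fin 2) (FiniteAdeleRing (𝓞 F) F)) : Matrix (Fin 2) (Fin 2) (FiniteAdeleRing (𝓞 F) F)) *ᵥ (⇑(algebraMap ℚ finAdeleQ) ∘ q)
            map_zero' := ?_
            map_add' := fun q q' => ?_ }, fun q => rfl⟩
  · have h : (⇑(algebraMap ℚ finAdeleQ) ∘ (0 : N → ℚ)) = 0 := by
      funext j; simp only [Function.comp_apply, Pi.zero_apply, map_zero]
    rw [h, Matrix.mulVec_zero]
  · have h : (⇑(algebraMap ℚ finAdeleQ) ∘ (q + q')) = (⇑(algebraMap ℚ finAdeleQ) ∘ q) + (⇑(algebraMap ℚ finAdeleQ) ∘ q') := by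
      funext j; simp only [Function.comp_apply, Pi.add_apply, map_add]
    rw [h, Matrix.mulVec_add]

/-- The away-integrality class `Away = {z | A(1−ε) z ∈ ẑ^N}` exists as an additive subgroup. [folklore] -/
private theorem exists_awaySubgroup :
    ∃ W : AddSubgroup (N → finAdeleQ), ∀ z : N → finAdeleQ,
      z ∈ W ↔ ∀ i, (A ((1 - ε) • (1 : Matrix (Fin 2) (Fin 2) (FiniteAdeleRing (𝓞 F) F))) *ᵥ z) i ∈ integralFiniteAdeles ℚ := by
  refine ⟨{ carrier := {z | ∀ i, (A ((1 - ε) • (1 : Matrix (Fin 2) (Fin 2) (FiniteAdeleRing (𝓞 F) F))) *ᵥ z) i ∈ integralFiniteAdeles ℚ}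
            add_mem' := fun {z z'} hz hz' i => ?_
            zero_mem' := fun i => by rw [Matrix.mulVec_zero]; exact zero_mem _
            neg_mem' := fun {z} hz i => by rw [Matrix.mulVec_neg, Pi.neg_apply]; exact neg_mem (hz i) }, fun z => Iff.rfl⟩
  rw [Matrix.mulVec_add, Pi.add_apply]
  exact add_mem (hz i) (hz' i)

/-- The reading of `ρ(b) q` in the `a`-frame: `A(a⁻¹)(ρ b q)^ = A(b•1) (A(a⁻¹) q̂)`. [folklore] -/
private theorem read_mulVec_eq
    (ρ : 𝓞 F →+* Matrix N N ℚ)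
    (hρ : ∀ b : 𝓞 F, (ρ b).map (algebraMap ℚ finAdeleQ) =
      A ((algebraMap F (FiniteAdeleRing (𝓞 F) F) ((b : 𝓞 F) : F)) • (1 : Matrix (Fin 2) (Fin 2) (FiniteAdeleRing (𝓞 F) F))))
    (a : GL (Fin 2) (FiniteAdeleRing (𝓞 F) F)) (b : 𝓞 F) (q : N → ℚ) :
    A ((a⁻¹ : GL (Fin 2) (FiniteAdeleRing (𝓞 F) F)) : Matrix (Fin 2) (Fin 2) (FiniteAdeleRing (𝓞 F) F)) *ᵥ (⇑(algebraMap ℚ finAdeleQ) ∘ (ρ b *ᵥ q)) =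
      A ((algebraMap F (FiniteAdeleRing (𝓞 F) F) ((b : 𝓞 F) : F)) • (1 : Matrix (Fin 2) (Fin 2) (FiniteAdeleRing (𝓞 F) F))) *ᵥ (A ((a⁻¹ : GL (Fin 2) (FiniteAdeleRing (𝓞 F) F)) : Matrix (Fin 2) (Fin 2) (FiniteAdeleRing (𝓞 F) F)) *ᵥ (⇑(algebraMap ℚ finAdeleQ) ∘ q)) := by
  have h1 : (⇑(algebraMap ℚ finAdeleQ) ∘ (ρ b *ᵥ q)) = (ρ b).map (algebraMap ℚ finAdeleQ) *ᵥ (⇑(algebraMap ℚ finAdeleQ) ∘ q) := by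
    funext i
    exact RingHom.map_mulVec (algebraMap ℚ finAdeleQ) (ρ b) q i
  rw [h1, hρ, Matrix.mulVec_mulVec, Matrix.mulVec_mulVec, ← map_mul, ← map_mul, Matrix.mul_smul, Matrix.mul_one, Matrix.smul_mul,
    Matrix.one_mul]

/-- **`Λ_a` is `ρ(𝓞_F)`-stable**: `A(𝓞_F) ⊆ M_N(ẑ)` (`hint`) and `A(a⁻¹)(ρ b q)^ = A(b)·A(a⁻¹)q̂`. [cite: Milne2005ShimuraVarieties, §4 pp. 48–49]
[cite: ShimuraIATAF1971, §3.2] -/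
theorem mulVec_mem_latticeOfGL_map
    (hint : ∀ (b : 𝓞 F) (z : N → finAdeleQ), (∀ i, z i ∈ integralFiniteAdeles ℚ) →
      ∀ i, (A ((algebraMap F (FiniteAdeleRing (𝓞 F) F) ((b : 𝓞 F) : F)) • (1 : Matrix (Fin 2) (Fin 2) (FiniteAdeleRing (𝓞 F) F))) *ᵥ z) i ∈
        integralFiniteAdeles ℚ)
    (ρ : 𝓞 F →+* Matrix N N ℚ)
    (hρ : ∀ b : 𝓞 F, (ρ b).map (algebraMap ℚ finAdeleQ) =
      A ((algebraMap F (FiniteAdeleRing (𝓞 F) F) ((b : 𝓞 F) : F)) • (1 : Matrix (Fin 2) (Fin 2) (FiniteAdeleRing (𝓞 F) F))))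
    (a : GL (Fin 2) (FiniteAdeleRing (𝓞 F) F)) (b : 𝓞 F) {q : N → ℚ} (hq : q ∈ latticeOfGL (Units.map (A : Matrix (Fin 2) (Fin 2) (FiniteAdeleRing (𝓞 F) F) →* Matrix N N finAdeleQ) a)) :
    ρ b *ᵥ q ∈ latticeOfGL (Units.map (A : Matrix (Fin 2) (Fin 2) (FiniteAdeleRing (𝓞 F) F) →* Matrix N N finAdeleQ) a) := by
  rw [mem_latticeOfGL_iff, Units.coe_map_inv] at hq ⊢
  change ∀ i, (A ((a⁻¹ : GL (Fin 2) (FiniteAdeleRing (𝓞 F) F)) : Matrix (Fin 2) (Fin 2) (FiniteAdeleRing (𝓞 F) F)) *ᵥ (⇑(algebraMap ℚ finAdeleQ) ∘ (ρ b *ᵥ q))) i ∈ integralFiniteAdeles ℚ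
  rw [read_mulVec_eq A ρ hρ a b q]
  exact hint b _ hq

/-- **`𝔞⁻¹Λ_a ⊓ 𝔟⁻¹Λ_{a′}` is `ρ(𝓞_F)`-stable** (`𝓞_F` is commutative and both `Λ`'s are stable). [cite: ShimuraIATAF1971, §3.2] -/
theorem mulVec_mem_of_forall_mulVec_mem
    (hint : ∀ (b : 𝓞 F) (z : N → finAdeleQ), (∀ i, z i ∈ integralFiniteAdeles ℚ) →
      ∀ i, (A ((algebraMap F (FiniteAdeleRing (𝓞 F) F) ((b : 𝓞 F) : F)) • (1 : Matrix (Fin 2) (Fin 2) (FiniteAdeleRing (𝓞 F) F))) *ᵥ z) i ∈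
        integralFiniteAdeles ℚ)
    (ρ : 𝓞 F →+* Matrix N N ℚ)
    (hρ : ∀ b : 𝓞 F, (ρ b).map (algebraMap ℚ finAdeleQ) =
      A ((algebraMap F (FiniteAdeleRing (𝓞 F) F) ((b : 𝓞 F) : F)) • (1 : Matrix (Fin 2) (Fin 2) (FiniteAdeleRing (𝓞 F) F))))
    (a a' : GL (Fin 2) (FiniteAdeleRing (𝓞 F) F)) (𝔞 𝔟 : Set (𝓞 F)) (b : 𝓞 F) {q : N → ℚ}
    (hq : (∀ π ∈ 𝔞, ρ π *ᵥ q ∈ latticeOfGL (Units.map (A : Matrix (Fin 2) (Fin 2) (FiniteAdeleRing (𝓞 F) F) →* Matrix N N finAdeleQ) a)) ∧ ∀ π ∈ 𝔟, ρ π *ᵥ q ∈ latticeOfGL (Units.map (A : Matrix (Fin 2) (Fin 2) (FiniteAdeleRing (𝓞 F) F) →* Matrix N N finAdeleQ) a')) :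
    (∀ π ∈ 𝔞, ρ π *ᵥ (ρ b *ᵥ q) ∈ latticeOfGL (Units.map (A : Matrix (Fin 2) (Fin 2) (FiniteAdeleRing (𝓞 F) F) →* Matrix N N finAdeleQ) a)) ∧ ∀ π ∈ 𝔟, ρ π *ᵥ (ρ b *ᵥ q) ∈ latticeOfGL (Units.map (A : Matrix (Fin 2) (Fin 2) (FiniteAdeleRing (𝓞 F) F) →* Matrix N N finAdeleQ) a') := by
  have hc : ∀ π : 𝓞 F, ρ π *ᵥ (ρ b *ᵥ q) = ρ b *ᵥ (ρ π *ᵥ q) := fun π => by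
    rw [Matrix.mulVec_mulVec, Matrix.mulVec_mulVec, ← map_mul, ← map_mul, mul_comm]
  exact ⟨fun π hπ => by rw [hc]; exact mulVec_mem_latticeOfGL_map A hint ρ hρ a b (hq.1 π hπ),
    fun π hπ => by rw [hc]; exact mulVec_mem_latticeOfGL_map A hint ρ hρ a' b (hq.2 π hπ)⟩

/-! ### §2 (L-c′) The index of `Λ_a` in `𝔭_{u₀}⁻¹Λ_a` is `q²` -/

/-- **(L-c′) `[𝔭_{u₀}⁻¹Λ_a : Λ_a] = q²`.**  Both lattices are readouts through `(ι_a, θ)`: `Λ_a = ι⁻¹(Away ⊓ θ⁻¹B(m,m))` (7a) and `𝔭⁻¹Λ_a = ι⁻¹(Away ⊓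
θ⁻¹B(m−1,m−1))` (7b); by density (8) the index is the local one (★ `relIndex_comap_readout_eq`), and `[B(m−1,m−1) : B(m,m)] = q²` (★ `relIndex_ball_eq_pow`).
[cite: ShimuraIATAF1971, §3.2 Lemma 3.23] [cite: Milne2005ShimuraVarieties, §6 Thm. 6.11 p. 74 and p. 75] [cite: PlatonovRapinchuk1994, §8.1] -/
theorem relIndex_latticeOfGL_map_idealInv_eq_sq
    (hsplit : ∀ z : N → finAdeleQ, (∀ i, z i ∈ integralFiniteAdeles ℚ) ↔
      (∀ i, (A (ε • (1 : Matrix (Fin 2) (Fin 2) (FiniteAdeleRing (𝓞 F) F))) *ᵥ z) i ∈ integralFiniteAdeles ℚ) ∧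
      (∀ i, (A ((1 - ε) • (1 : Matrix (Fin 2) (Fin 2) (FiniteAdeleRing (𝓞 F) F))) *ᵥ z) i ∈ integralFiniteAdeles ℚ))
    (hθint : ∀ z : N → finAdeleQ,
      (∀ i, (A (ε • (1 : Matrix (Fin 2) (Fin 2) (FiniteAdeleRing (𝓞 F) F))) *ᵥ z) i ∈ integralFiniteAdeles ℚ) ↔
        ∀ j, Valued.v (θ z j) ≤ WithZero.exp (-m))
    (hθA : ∀ (X : Matrix (Fin 2) (Fin 2) (FiniteAdeleRing (𝓞 F) F)) (z : N → finAdeleQ),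
      θ (A X *ᵥ z) = (X.map fun x : FiniteAdeleRing (𝓞 F) F => x u₀) *ᵥ θ z)
    (haway : ∀ z : N → finAdeleQ,
      (∀ π ∈ u₀.asIdeal, ∀ i, (A (((1 - ε) * algebraMap F (FiniteAdeleRing (𝓞 F) F) ((π : 𝓞 F) : F)) •
        (1 : Matrix (Fin 2) (Fin 2) (FiniteAdeleRing (𝓞 F) F))) *ᵥ z) i ∈ integralFiniteAdeles ℚ) →
      ∀ i, (A ((1 - ε) • (1 : Matrix (Fin 2) (Fin 2) (FiniteAdeleRing (𝓞 F) F))) *ᵥ z) i ∈ integralFiniteAdeles ℚ)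
    (hint : ∀ (b : 𝓞 F) (z : N → finAdeleQ), (∀ i, z i ∈ integralFiniteAdeles ℚ) →
      ∀ i, (A ((algebraMap F (FiniteAdeleRing (𝓞 F) F) ((b : 𝓞 F) : F)) • (1 : Matrix (Fin 2) (Fin 2) (FiniteAdeleRing (𝓞 F) F))) *ᵥ z) i ∈
        integralFiniteAdeles ℚ)
    (ρ : 𝓞 F →+* Matrix N N ℚ)
    (hρ : ∀ b : 𝓞 F, (ρ b).map (algebraMap ℚ finAdeleQ) =
      A ((algebraMap F (FiniteAdeleRing (𝓞 F) F) ((b : 𝓞 F) : F)) • (1 : Matrix (Fin 2) (Fin 2) (FiniteAdeleRing (𝓞 F) F))))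
    (hθsurj : Function.Surjective θ) (hε : ε * ε = ε) (hε₁ : ε u₀ = 1)
    {p : ℕ} (hp : p ≠ 0) (hpu : ((p : 𝓞 F)) ∈ u₀.asIdeal)
    (a : GL (Fin 2) (FiniteAdeleRing (𝓞 F) F)) (L' : Submodule ℤ (N → ℚ))
    (hL' : ∀ q : N → ℚ, q ∈ L' ↔ ∀ π ∈ u₀.asIdeal, ρ π *ᵥ q ∈ latticeOfGL (Units.map (A : Matrix (Fin 2) (Fin 2) (FiniteAdeleRing (𝓞 F) F) →* Matrix N N finAdeleQ) a)) :
    (latticeOfGL (Units.map (A : Matrix (Fin 2) (Fin 2) (FiniteAdeleRing (𝓞 F) F) →* Matrix N N finAdeleQ) a)).toAddSubgroup.relIndex L'.toAddSubgroup = Nat.card (𝓞 F ⧸ u₀.asIdeal) ^ 2 := by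
  obtain ⟨ι, hι⟩ := exists_readHom A a
  obtain ⟨W, hW⟩ := exists_awaySubgroup A ε
  obtain ⟨B₁, hB₁⟩ := exists_addSubgroup_ball F u₀ (fun _ : Fin 2 => m)
  obtain ⟨B₂, hB₂⟩ := exists_addSubgroup_ball F u₀ (fun _ : Fin 2 => m - 1)
  have hB₁' : ∀ ℓ, ℓ ∈ B₁ ↔ ∀ j, Valued.v (ℓ j) ≤ WithZero.exp (-m) := hB₁
  have hB₂' : ∀ ℓ, ℓ ∈ B₂ ↔ ∀ j, Valued.v (ℓ j) ≤ WithZero.exp (-(m - 1)) := hB₂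
  have hΛ : (latticeOfGL (Units.map (A : Matrix (Fin 2) (Fin 2) (FiniteAdeleRing (𝓞 F) F) →* Matrix N N finAdeleQ) a)).toAddSubgroup = (W ⊓ B₁.comap θ).comap ι := by
    ext q
    rw [Submodule.mem_toAddSubgroup, mem_comap_readout_iff, hW, hB₁', hι, mem_latticeOfGL_map_iff_readout A u₀ ε θ m hsplit hθint a q]
  have hL : L'.toAddSubgroup = (W ⊓ B₂.comap θ).comap ι := by
    ext q
    rw [Submodule.mem_toAddSubgroup, hL', mem_comap_readout_iff, hW, hB₂', hι,
      forall_mulVec_mem_latticeOfGL_map_iff_readout A u₀ ε θ m hsplit hθint hθA haway hint ρ hρ a q]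
  have h12 : B₁ ≤ B₂ := fun ℓ hℓ => (hB₂' ℓ).2 fun j => ((hB₁' ℓ).1 hℓ j).trans (WithZero.exp_le_exp.2 (by omega))
  have hdense : ∀ e ∈ B₂, ∃ v : N → ℚ, ι v ∈ W ∧ θ (ι v) - e ∈ B₁ := by
    intro e he
    obtain ⟨q, hqA, hq⟩ := exists_rat_readout_sub_mem A u₀ ε θ m hsplit hθint hθA hθsurj hε hε₁ hp hpu a 1 e
      (fun j => by rw [Nat.cast_one]; exact (hB₂' e).1 he j)
    exact ⟨q, (hW _).2 (by rw [hι]; exact hqA), (hB₁' _).2 (by rw [hι]; exact hq)⟩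
  have hB₁'' : ∀ ℓ, ℓ ∈ B₁ ↔ ∀ j : Fin 2, Valued.v (ℓ j) ≤ WithZero.exp (-((fun _ : Fin 2 => m - 1) j + ((fun _ : Fin 2 => (1 : ℕ)) j : ℤ))) :=
    fun ℓ => by simp only [Nat.cast_one, sub_add_cancel]; exact hB₁' ℓ
  rw [hΛ, hL, relIndex_comap_readout_eq ι θ W h12 hdense, relIndex_ball_eq_pow F u₀ (fun _ : Fin 2 => m - 1) (fun _ => 1) B₁ B₂ hB₁'' hB₂]
  simp only [Finset.sum_const, Finset.card_univ, Fintype.card_fin, smul_eq_mul, mul_one]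

/-- **`Λ_a ≤ 𝔭_{u₀}⁻¹Λ_a`** (`Λ_a` is `ρ`-stable). [cite: ShimuraIATAF1971, §3.2] -/
theorem latticeOfGL_map_le_idealInv
    (hint : ∀ (b : 𝓞 F) (z : N → finAdeleQ), (∀ i, z i ∈ integralFiniteAdeles ℚ) →
      ∀ i, (A ((algebraMap F (FiniteAdeleRing (𝓞 F) F) ((b : 𝓞 F) : F)) • (1 : Matrix (Fin 2) (Fin 2) (FiniteAdeleRing (𝓞 F) F))) *ᵥ z) i ∈
        integralFiniteAdeles ℚ)
    (ρ : 𝓞 F →+* Matrix N N ℚ)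
    (hρ : ∀ b : 𝓞 F, (ρ b).map (algebraMap ℚ finAdeleQ) =
      A ((algebraMap F (FiniteAdeleRing (𝓞 F) F) ((b : 𝓞 F) : F)) • (1 : Matrix (Fin 2) (Fin 2) (FiniteAdeleRing (𝓞 F) F))))
    (a : GL (Fin 2) (FiniteAdeleRing (𝓞 F) F)) (L' : Submodule ℤ (N → ℚ))
    (hL' : ∀ q : N → ℚ, q ∈ L' ↔ ∀ π ∈ u₀.asIdeal, ρ π *ᵥ q ∈ latticeOfGL (Units.map (A : Matrix (Fin 2) (Fin 2) (FiniteAdeleRing (𝓞 F) F) →* Matrix N N finAdeleQ) a)) :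
    latticeOfGL (Units.map (A : Matrix (Fin 2) (Fin 2) (FiniteAdeleRing (𝓞 F) F) →* Matrix N N finAdeleQ) a) ≤ L' :=
  fun _ hq => (hL' _).2 fun π _ => mulVec_mem_latticeOfGL_map A hint ρ hρ a π hq

/-! ### §3 (L-c′) Exhaustion: `q + 1` injective stable neighbours are all of them -/

/-- **EXHAUSTION.**  With `q = #(𝓞_F ∕ 𝔭_{u₀})`: an INJECTIVE family of `q + 1` `ρ`-stable lattices `Λ_a ≤ H_i ≤ 𝔭_{u₀}⁻¹Λ_a` of index `q` contains EVERY
`ρ`-stable lattice `Λ_a ≤ L ≤ 𝔭_{u₀}⁻¹Λ_a` of index `q` — the `q + 1` stable lines of the `𝔽_q`-plane `𝔭⁻¹Λ_a ∕ Λ_a` (★ `exists_eq_of_injective_stableLattice`,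
`[𝔭⁻¹Λ_a : Λ_a] = q²` by §2).  This is `hexh` of ★ `exists_stableLines`. [cite: ShimuraIATAF1971, §3.2 Lemma 3.23] [cite: DiamondShurman2005, §5.2]
[cite: Milne2005ShimuraVarieties, §6 p. 75] -/
theorem exists_eq_of_injective_heckeNeighbour
    (hsplit : ∀ z : N → finAdeleQ, (∀ i, z i ∈ integralFiniteAdeles ℚ) ↔
      (∀ i, (A (ε • (1 : Matrix (Fin 2) (Fin 2) (FiniteAdeleRing (𝓞 F) F))) *ᵥ z) i ∈ integralFiniteAdeles ℚ) ∧
      (∀ i, (A ((1 - ε) • (1 : Matrix (Fin 2) (Fin 2) (FiniteAdeleRing (𝓞 F) F))) *ᵥ z) i ∈ integralFiniteAdeles ℚ))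
    (hθint : ∀ z : N → finAdeleQ,
      (∀ i, (A (ε • (1 : Matrix (Fin 2) (Fin 2) (FiniteAdeleRing (𝓞 F) F))) *ᵥ z) i ∈ integralFiniteAdeles ℚ) ↔
        ∀ j, Valued.v (θ z j) ≤ WithZero.exp (-m))
    (hθA : ∀ (X : Matrix (Fin 2) (Fin 2) (FiniteAdeleRing (𝓞 F) F)) (z : N → finAdeleQ),
      θ (A X *ᵥ z) = (X.map fun x : FiniteAdeleRing (𝓞 F) F => x u₀) *ᵥ θ z)
    (haway : ∀ z : N → finAdeleQ,
      (∀ π ∈ u₀.asIdeal, ∀ i, (A (((1 - ε) * algebraMap F (FiniteAdeleRing (𝓞 F) F) ((π : 𝓞 F) : F)) •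
        (1 : Matrix (Fin 2) (Fin 2) (FiniteAdeleRing (𝓞 F) F))) *ᵥ z) i ∈ integralFiniteAdeles ℚ) →
      ∀ i, (A ((1 - ε) • (1 : Matrix (Fin 2) (Fin 2) (FiniteAdeleRing (𝓞 F) F))) *ᵥ z) i ∈ integralFiniteAdeles ℚ)
    (hint : ∀ (b : 𝓞 F) (z : N → finAdeleQ), (∀ i, z i ∈ integralFiniteAdeles ℚ) →
      ∀ i, (A ((algebraMap F (FiniteAdeleRing (𝓞 F) F) ((b : 𝓞 F) : F)) • (1 : Matrix (Fin 2) (Fin 2) (FiniteAdeleRing (𝓞 F) F))) *ᵥ z) i ∈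
        integralFiniteAdeles ℚ)
    (ρ : 𝓞 F →+* Matrix N N ℚ)
    (hρ : ∀ b : 𝓞 F, (ρ b).map (algebraMap ℚ finAdeleQ) =
      A ((algebraMap F (FiniteAdeleRing (𝓞 F) F) ((b : 𝓞 F) : F)) • (1 : Matrix (Fin 2) (Fin 2) (FiniteAdeleRing (𝓞 F) F))))
    (hθsurj : Function.Surjective θ) (hε : ε * ε = ε) (hε₁ : ε u₀ = 1)
    {p : ℕ} (hp : p ≠ 0) (hpu : ((p : 𝓞 F)) ∈ u₀.asIdeal)
    (a : GL (Fin 2) (FiniteAdeleRing (𝓞 F) F)) {β : Type*} (hβ : Nat.card β = Nat.card (𝓞 F ⧸ u₀.asIdeal) + 1)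
    (Hfam : β → Submodule ℤ (N → ℚ)) (hinj : Function.Injective Hfam)
    (hΛ : ∀ i, latticeOfGL (Units.map (A : Matrix (Fin 2) (Fin 2) (FiniteAdeleRing (𝓞 F) F) →* Matrix N N finAdeleQ) a) ≤ Hfam i)
    (h𝔭 : ∀ i, ∀ v ∈ Hfam i, ∀ π ∈ u₀.asIdeal, ρ π *ᵥ v ∈ latticeOfGL (Units.map (A : Matrix (Fin 2) (Fin 2) (FiniteAdeleRing (𝓞 F) F) →* Matrix N N finAdeleQ) a))
    (hcard : ∀ i, (latticeOfGL (Units.map (A : Matrix (Fin 2) (Fin 2) (FiniteAdeleRing (𝓞 F) F) →* Matrix N N finAdeleQ) a)).toAddSubgroup.relIndex (Hfam i).toAddSubgroup = Nat.card (𝓞 F ⧸ u₀.asIdeal))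
    (hst : ∀ i b, ∀ v ∈ Hfam i, ρ b *ᵥ v ∈ Hfam i)
    (L : Submodule ℤ (N → ℚ)) (hL : latticeOfGL (Units.map (A : Matrix (Fin 2) (Fin 2) (FiniteAdeleRing (𝓞 F) F) →* Matrix N N finAdeleQ) a) ≤ L)
    (hL𝔭 : ∀ v ∈ L, ∀ π ∈ u₀.asIdeal, ρ π *ᵥ v ∈ latticeOfGL (Units.map (A : Matrix (Fin 2) (Fin 2) (FiniteAdeleRing (𝓞 F) F) →* Matrix N N finAdeleQ) a))
    (hLcard : (latticeOfGL (Units.map (A : Matrix (Fin 2) (Fin 2) (FiniteAdeleRing (𝓞 F) F) →* Matrix N N finAdeleQ) a)).toAddSubgroup.relIndex L.toAddSubgroup = Nat.card (𝓞 F ⧸ u₀.asIdeal))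
    (hLst : ∀ b, ∀ v ∈ L, ρ b *ᵥ v ∈ L) :
    ∃ i, Hfam i = L := by
  haveI : u₀.asIdeal.IsMaximal := u₀.isMaximal
  haveI : Finite (𝓞 F ⧸ u₀.asIdeal) := Ideal.finiteQuotientOfFreeOfNeBot u₀.asIdeal u₀.ne_bot
  obtain ⟨L', hL'⟩ := exists_submodule_forall_mulVec_mem ρ (u₀.asIdeal : Set (𝓞 F)) (latticeOfGL (Units.map (A : Matrix (Fin 2) (Fin 2) (FiniteAdeleRing (𝓞 F) F) →* Matrix N N finAdeleQ) a))
  have hL'' : ∀ q : N → ℚ, q ∈ L' ↔ ∀ π ∈ u₀.asIdeal, ρ π *ᵥ q ∈ latticeOfGL (Units.map (A : Matrix (Fin 2) (Fin 2) (FiniteAdeleRing (𝓞 F) F) →* Matrix N N finAdeleQ) a) := hL'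
  have hΛL : latticeOfGL (Units.map (A : Matrix (Fin 2) (Fin 2) (FiniteAdeleRing (𝓞 F) F) →* Matrix N N finAdeleQ) a) ≤ L' := latticeOfGL_map_le_idealInv A u₀ hint ρ hρ a L' hL''
  have hΛst : ∀ b, ∀ v ∈ latticeOfGL (Units.map (A : Matrix (Fin 2) (Fin 2) (FiniteAdeleRing (𝓞 F) F) →* Matrix N N finAdeleQ) a), ρ b *ᵥ v ∈ latticeOfGL (Units.map (A : Matrix (Fin 2) (Fin 2) (FiniteAdeleRing (𝓞 F) F) →* Matrix N N finAdeleQ) a) := fun b v hv => mulVec_mem_latticeOfGL_map A hint ρ hρ a b hv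
  have hL'st : ∀ b, ∀ v ∈ L', ρ b *ᵥ v ∈ L' := by
    intro b v hv
    have h := mulVec_mem_of_forall_mulVec_mem A hint ρ hρ a a (u₀.asIdeal : Set (𝓞 F)) (u₀.asIdeal : Set (𝓞 F)) b ⟨(hL'' v).1 hv, (hL'' v).1 hv⟩
    exact (hL'' _).2 h.1
  have h𝔭L' : ∀ b ∈ u₀.asIdeal, ∀ v ∈ L', ρ b *ᵥ v ∈ latticeOfGL (Units.map (A : Matrix (Fin 2) (Fin 2) (FiniteAdeleRing (𝓞 F) F) →* Matrix N N finAdeleQ) a) := fun b hb v hv => (hL'' v).1 hv b hb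
  have hidx := relIndex_latticeOfGL_map_idealInv_eq_sq A u₀ ε θ m hsplit hθint hθA haway hint ρ hρ hθsurj hε hε₁ hp hpu a L' hL''
  refine exists_eq_of_injective_stableLattice u₀.asIdeal ρ (latticeOfGL (Units.map (A : Matrix (Fin 2) (Fin 2) (FiniteAdeleRing (𝓞 F) F) →* Matrix N N finAdeleQ) a)) L' hΛL hΛst hL'st h𝔭L' hidx hβ Hfam hinj
    (fun i => ⟨hΛ i, fun v hv => (hL'' v).2 (h𝔭 i v hv), hst i, hcard i⟩) L ⟨hL, fun v hv => (hL'' v).2 (hL𝔭 v hv), hLst, hLcard⟩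

end Literature.NumberTheory.Adeles.Readout

end
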